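import Literature.MathematicalPhysics.QuantumLattice.HubbardTTPrimeSourcedMeanEnergyMinimisers
import Literature.MathematicalPhysics.QuantumLattice.InfVolFermionStateConstrainedMinimisers
import Literature.MathematicalPhysics.QuantumLattice.DWaveSourceEnergyDensityTwoStateClasses
import HarnessLib

/-!
# Ground-state rows of the CANONICAL class: chemical-potential-free KKT rows of fixed-density minimisers,
# the pair-sourced `t–t'` class by name, and existence of canonical minimisers at every density

Topic `Literature/MathematicalPhysics/QuantumLattice`; namespace = path. Reader layer on top of
`HubbardTTPrimeSourcedMeanEnergyMinimisers.lean` (`exists_isGroundState_pencil_number_of_canonical`: a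
translation-invariant minimiser of `e_Ψ` among translation-invariant states of the same density `ρ ∈ (0,2)` is,
for some chemical potential `μ`, a Bratteli–Robinson ground state of the pencil `Ψ − μ·n` — Ruelle's Lagrange
multiplier `CanonicalClassChemicalPotential.lean` × Bratteli–Kishimoto–Robinson Thm. 2
`MeanEnergyMinimisersAreGroundStates.lean`), of `FermionGroundStatesMinimiseMeanEnergy.lean` (the rows of a
ground state: stationarity `ω([H_{Λ_R}, ΓA]) = 0` and the Bratteli–Robinson inequality
`Re ω((ΓA)⋆[H_{Λ_R}, ΓA]) ≥ 0`) and of `InfVolFermionStateConstrainedMinimisers.lean` (fixed-filling minimisers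
exist). Written for the Hubbard cuprate cell (`hubbard-cq`), whose certified canonical response floors read
«every translation-invariant minimiser of the sourced energy at density `7/8`» (CQ-TABLE §B1-U) and whose KKT
certificates use number-CONSERVING words. Everything is PROVED; no definition, no named fact.

* §1 (model-free on `ℤ²`; `Ψ` Hermitian, even, translation invariant, range `R ≥ 0`; `ω` a canonical-class
  minimiser at density `ρ ∈ (0,2)`): `canonicalMinimiser_kkt` — for SOME `μ`, every local `A` obeys the two rows
  of `H^Ψ_{Λ_R} − μN_{Λ_R}`; `FermionInteraction.pencil_number_commutator_eq_of_commute` — for `A` commuting with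
  the local particle number the `μ`-term drops out of the commutator; hence
  **`canonicalMinimiser_kkt_of_commute_number`**: the `μ`-FREE rows `Re ω((ΓA)⋆[H^Ψ_{Λ_R}, ΓA]) ≥ 0`,
  `ω([H^Ψ_{Λ_R}, ΓA]) = 0` for every local `A` commuting with `N_{Λ_R}` — the rows a number-conserving
  certificate uses, with no chemical potential to know; `exists_canonicalMinimiser` — the canonical class of
  ANY interaction has a minimiser at every `ρ ∈ (0,2)` (weak-⋆ compactness), so
  `exists_isGroundState_pencil_number_of_density`: every `ρ ∈ (0,2)` is the density of a translation-invariant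
  ground state of some `Ψ − μ·n`.
* §2 the `t–t'` Hubbard model (`R = 1`): fixed-filling minimisers are minimisers AND ground states of
  `hubbardTTPrimeMuInteraction t t' U μ` for some `μ`; `μ`-free rows; every filling realised.
* §3 the PAIR-SOURCED `t–t'` model BY NAME: a density-`ρ` minimiser of
  `Ψ_h = hubbardTTPrimeSourcedInteraction t t' U 0 g h` is, for some `μ`, a minimiser and a ground state of
  `hubbardTTPrimeSourcedInteraction t t' U μ g h` (the pencil identified through
  `hubbardTTPrimeSourcedInteraction_eq_pencil_number`), with its `μ`-rows, its `μ`-free rows for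
  number-conserving words, and realisation of every density.

HONEST SCOPE. Exact minimisers only; `μ` is not computed (bracketed by data in `CanonicalClassChemicalPotential`
§4); nothing here is specific to `d`-wave beyond the form factor argument `g`; no number.

## References
* O. Bratteli, A. Kishimoto, D. W. Robinson, Commun. Math. Phys. 64 (1978) 41–48, Thm. 2.
  [cite: BratteliKishimotoRobinson1978, Thm. 2 (p. 47)]
* D. Ruelle, *Statistical Mechanics: Rigorous Results* (1969), §3.4. [cite: Ruelle1969, §3.4]
* O. Bratteli, D. W. Robinson, *OAQSM 2* (1997), Def. 5.3.18 / Prop. 5.3.19 (ground states), §6.2.4.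
  [cite: BratteliRobinsonII1997, §6.2.4]
* T. Koma, H. Tasaki, J. Stat. Phys. 76 (1994) 745, §1 (the sourced Hamiltonian `H − μN − hO`).
  [cite: KomaTasaki1994, §1]
-/

noncomputable section

namespace Literature.MathematicalPhysics.QuantumLattice

open Matrix Finset HubbardWave0 Literature.Probability.LatticeModels
open scoped ComplexOrder

variable {d : ℕ}

/-! ### §1. Rows of canonical-class minimisers (model-free, `ℤ²`) -/

namespace FermionInteraction

/-- **The chemical potential drops out of commutators with number-conserving observables**:
`[H^Ψ_Λ − μN_Λ, A] = [H^Ψ_Λ, A]` whenever `A` commutes with the local particle number `N_Λ = H^{Φ_n}_Λ`.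
[cite: BratteliRobinsonII1997, §6.2.4] -/
theorem pencil_number_commutator_eq_of_commute (Ψ : FermionInteraction d) (μ : ℝ) (Λ : Finset (Site d))
    {A : FermionOp Λ} (hA : Commute ((numberInteraction d).localHamiltonian Λ) A) :
    (pencil Ψ (numberInteraction d) (-μ)).localHamiltonian Λ * A -
        A * (pencil Ψ (numberInteraction d) (-μ)).localHamiltonian Λ =
      Ψ.localHamiltonian Λ * A - A * Ψ.localHamiltonian Λ := by
  rw [localHamiltonian_pencil, add_mul, mul_add, Matrix.smul_mul, Matrix.mul_smul, hA.eq]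
  abel

end FermionInteraction

namespace InfVolFermionState

open FermionInteraction

variable {Ψ : FermionInteraction 2} {R : ℝ}

/-- **A canonical-class minimiser is a minimiser AND a ground state of `Ψ − μ·n` for one `μ`** (the two
conclusions with the SAME chemical potential: Lagrange `isMeanEnergyMinimiser_pencil_number_of_canonical`, then
Bratteli–Kishimoto–Robinson `2 ⇒ 1`). [cite: BratteliKishimotoRobinson1978, Thm. 2 (p. 47)] [cite: Ruelle1969, §3.4] -/
theorem exists_isMeanEnergyMinimiser_isGroundState_of_canonicalMinimiser (hR : 0 ≤ R) (hH : Ψ.IsHermitian)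
    (hE : Ψ.IsEven) (hT : Ψ.IsTranslationInvariant) (hF : Ψ.HasFiniteRange R)
    {ω : InfVolFermionState 2} (hω : ω.IsTranslationInvariant) {ρ : ℝ} (hρ : ω.density = ρ) (hρ0 : 0 < ρ)
    (hρ2 : ρ < 2)
    (hmin : ∀ σ : InfVolFermionState 2, σ.IsTranslationInvariant → σ.density = ρ →
      ω.meanEnergy Ψ R ≤ σ.meanEnergy Ψ R) :
    ∃ μ : ℝ, ω.IsMeanEnergyMinimiser (pencil Ψ (numberInteraction 2) (-μ)) R ∧
      ω.IsGroundState (pencil Ψ (numberInteraction 2) (-μ)) R := by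
  obtain ⟨μ, hμ⟩ := isMeanEnergyMinimiser_pencil_number_of_canonical Ψ R hω hρ hρ0 hρ2 hmin
  exact ⟨μ, hμ, hμ.isGroundState two_pos (hasFiniteRange_pencil hF (numberInteraction_hasFiniteRange R hR) _)
    (isHermitian_pencil hH numberInteraction_isHermitian _) (isEven_pencil hE numberInteraction_isEven _)
    (isTranslationInvariant_pencil hT numberInteraction_isTranslationInvariant _)⟩

/-- **KKT rows of a canonical-class minimiser** (with its chemical potential): for some `μ`, every local `A`
satisfies the Bratteli–Robinson inequality `Re ω((ΓA)⋆[H^{Ψ−μn}_{Λ_R}, ΓA]) ≥ 0` and stationarity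
`ω([H^{Ψ−μn}_{Λ_R}, ΓA]) = 0`, `H^{Ψ−μn}_{Λ_R} = H^Ψ_{Λ_R} − μ N_{Λ_R}`. [cite: BratteliKishimotoRobinson1978, Thm. 2 (p. 47)] -/
theorem canonicalMinimiser_kkt (hR : 0 ≤ R) (hH : Ψ.IsHermitian) (hE : Ψ.IsEven)
    (hT : Ψ.IsTranslationInvariant) (hF : Ψ.HasFiniteRange R)
    {ω : InfVolFermionState 2} (hω : ω.IsTranslationInvariant) {ρ : ℝ} (hρ : ω.density = ρ) (hρ0 : 0 < ρ)
    (hρ2 : ρ < 2)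
    (hmin : ∀ σ : InfVolFermionState 2, σ.IsTranslationInvariant → σ.density = ρ →
      ω.meanEnergy Ψ R ≤ σ.meanEnergy Ψ R) :
    ∃ μ : ℝ, ∀ (Λ : Finset (Site 2)) (A : FermionOp Λ),
      0 ≤ (ω.expect (thicken Λ R) ((fermionEmbed (PolySite.incl (subset_thicken Λ R)) A)ᴴ *
        ((pencil Ψ (numberInteraction 2) (-μ)).localHamiltonian (thicken Λ R) *
            fermionEmbed (PolySite.incl (subset_thicken Λ R)) A -
          fermionEmbed (PolySite.incl (subset_thicken Λ R)) A *
            (pencil Ψ (numberInteraction 2) (-μ)).localHamiltonian (thicken Λ R)))).re ∧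
      ω.expect (thicken Λ R)
        ((pencil Ψ (numberInteraction 2) (-μ)).localHamiltonian (thicken Λ R) *
            fermionEmbed (PolySite.incl (subset_thicken Λ R)) A -
          fermionEmbed (PolySite.incl (subset_thicken Λ R)) A *
            (pencil Ψ (numberInteraction 2) (-μ)).localHamiltonian (thicken Λ R)) = 0 := by
  obtain ⟨μ, hgs⟩ := exists_isGroundState_pencil_number_of_canonical Ψ hR hF hH hE hT hω hρ hρ0 hρ2 hmin
  exact ⟨μ, fun Λ A => ⟨hgs.re_expect_conj_commutator_nonneg Λ A, hgs.expect_commutator_localHamiltonian_eq_zero Λ A⟩⟩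

/-- **The `μ`-free KKT rows of a canonical-class minimiser**: for every local `A` commuting with the local
particle number `N_{Λ_R}` (number-conserving words: densities, hoppings, `c†c†cc`, …) a canonical-class
minimiser of `e_Ψ` satisfies `Re ω((ΓA)⋆[H^Ψ_{Λ_R}, ΓA]) ≥ 0` and `ω([H^Ψ_{Λ_R}, ΓA]) = 0` — the same rows as a
translation-invariant ground state of `Ψ` itself, with no chemical potential to know.
[cite: BratteliKishimotoRobinson1978, Thm. 2 (p. 47)] -/
theorem canonicalMinimiser_kkt_of_commute_number (hR : 0 ≤ R) (hH : Ψ.IsHermitian) (hE : Ψ.IsEven)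
    (hT : Ψ.IsTranslationInvariant) (hF : Ψ.HasFiniteRange R)
    {ω : InfVolFermionState 2} (hω : ω.IsTranslationInvariant) {ρ : ℝ} (hρ : ω.density = ρ) (hρ0 : 0 < ρ)
    (hρ2 : ρ < 2)
    (hmin : ∀ σ : InfVolFermionState 2, σ.IsTranslationInvariant → σ.density = ρ →
      ω.meanEnergy Ψ R ≤ σ.meanEnergy Ψ R)
    (Λ : Finset (Site 2)) (A : FermionOp Λ)
    (hA : Commute ((numberInteraction 2).localHamiltonian (thicken Λ R))
      (fermionEmbed (PolySite.incl (subset_thicken Λ R)) A)) :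
    0 ≤ (ω.expect (thicken Λ R) ((fermionEmbed (PolySite.incl (subset_thicken Λ R)) A)ᴴ *
        (Ψ.localHamiltonian (thicken Λ R) * fermionEmbed (PolySite.incl (subset_thicken Λ R)) A -
          fermionEmbed (PolySite.incl (subset_thicken Λ R)) A * Ψ.localHamiltonian (thicken Λ R)))).re ∧
      ω.expect (thicken Λ R)
        (Ψ.localHamiltonian (thicken Λ R) * fermionEmbed (PolySite.incl (subset_thicken Λ R)) A -
          fermionEmbed (PolySite.incl (subset_thicken Λ R)) A * Ψ.localHamiltonian (thicken Λ R)) = 0 := by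
  obtain ⟨μ, hkkt⟩ := canonicalMinimiser_kkt hR hH hE hT hF hω hρ hρ0 hρ2 hmin
  obtain ⟨h2, h1⟩ := hkkt Λ A
  rw [pencil_number_commutator_eq_of_commute Ψ μ (thicken Λ R) hA] at h2 h1
  exact ⟨h2, h1⟩

/-- **The canonical class has a minimiser at every density `ρ ∈ (0,2)`**, for every interaction `Ψ` on `ℤ²`
and every range parameter `R` (every such density is realised, `exists_isTranslationInvariant_density_eq`;
weak-⋆ compactness, `exists_isMinOn_filling`). [cite: Ruelle1969, §3.4] -/
theorem exists_canonicalMinimiser (Ψ : FermionInteraction 2) (R : ℝ) {ρ : ℝ} (hρ0 : 0 < ρ) (hρ2 : ρ < 2) :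
    ∃ ω : InfVolFermionState 2, ω.IsTranslationInvariant ∧ ω.density = ρ ∧
      ∀ σ : InfVolFermionState 2, σ.IsTranslationInvariant → σ.density = ρ →
        ω.meanEnergy Ψ R ≤ σ.meanEnergy Ψ R := by
  obtain ⟨ω, hω, hmin⟩ := Ψ.exists_isMinOn_filling R (exists_isTranslationInvariant_density_eq hρ0 hρ2)
  exact ⟨ω, hω.1, hω.2, fun σ hσ hσρ => hmin ⟨hσ, hσρ⟩⟩

/-- **Every density in `(0,2)` is the density of a translation-invariant ground state of some `Ψ − μ·n`**
(`Ψ` Hermitian, even, translation invariant, of range `R ≥ 0` on `ℤ²`): a canonical-class minimiser at `ρ`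
and its chemical potential. [cite: BratteliKishimotoRobinson1978, Thm. 2 (p. 47)] [cite: Ruelle1969, §3.4] -/
theorem exists_isGroundState_pencil_number_of_density (hR : 0 ≤ R) (hH : Ψ.IsHermitian) (hE : Ψ.IsEven)
    (hT : Ψ.IsTranslationInvariant) (hF : Ψ.HasFiniteRange R) {ρ : ℝ} (hρ0 : 0 < ρ) (hρ2 : ρ < 2) :
    ∃ (μ : ℝ) (ω : InfVolFermionState 2), ω.IsTranslationInvariant ∧ ω.density = ρ ∧
      ω.IsMeanEnergyMinimiser (pencil Ψ (numberInteraction 2) (-μ)) R ∧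
      ω.IsGroundState (pencil Ψ (numberInteraction 2) (-μ)) R := by
  obtain ⟨ω, hω, hρ, hmin⟩ := exists_canonicalMinimiser Ψ R hρ0 hρ2
  obtain ⟨μ, hmm, hgs⟩ :=
    exists_isMeanEnergyMinimiser_isGroundState_of_canonicalMinimiser hR hH hE hT hF hω hρ hρ0 hρ2 hmin
  exact ⟨μ, ω, hω, hρ, hmm, hgs⟩

/-! ### §2. The `t–t'` Hubbard model -/

/-- **Fixed-filling minimisers of the `t–t'` Hubbard model are minimisers and ground states of `H^{tt'} − μN`**:
if `ω` is translation invariant of density `ρ ∈ (0,2)` and minimises `e^{tt'U}` among translation-invariant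
states of density `ρ`, then for some chemical potential `μ` it is a mean-energy minimiser and a ground state of
`hubbardTTPrimeMuInteraction t t' U μ` (range `1`). [cite: BratteliKishimotoRobinson1978, Thm. 2 (p. 47)] -/
theorem exists_isGroundState_hubbardTTPrimeMu_of_canonicalMinimiser {t t' U : ℝ} {ω : InfVolFermionState 2}
    (hω : ω.IsTranslationInvariant) {ρ : ℝ} (hρ : ω.density = ρ) (hρ0 : 0 < ρ) (hρ2 : ρ < 2)
    (hmin : ∀ σ : InfVolFermionState 2, σ.IsTranslationInvariant → σ.density = ρ →
      ω.meanEnergy (hubbardTTPrimeFermionInteraction t t' U) 1 ≤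
        σ.meanEnergy (hubbardTTPrimeFermionInteraction t t' U) 1) :
    ∃ μ : ℝ, ω.IsMeanEnergyMinimiser (hubbardTTPrimeMuInteraction t t' U μ) 1 ∧
      ω.IsGroundState (hubbardTTPrimeMuInteraction t t' U μ) 1 :=
  exists_isMeanEnergyMinimiser_isGroundState_of_canonicalMinimiser zero_le_one
    (hubbardTTPrimeFermionInteraction_isHermitian t t' U) (hubbardTTPrimeFermionInteraction_isEven t t' U)
    (hubbardTTPrimeFermionInteraction_isTranslationInvariant t t' U)
    (hubbardTTPrimeFermionInteraction_hasFiniteRange t t' U) hω hρ hρ0 hρ2 hmin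

/-- **`μ`-free KKT rows of a fixed-filling `t–t'` minimiser**: every local `A` commuting with the local
particle number `N_{Λ_1}` satisfies `Re ω((ΓA)⋆[H^{tt'}_{Λ_1}, ΓA]) ≥ 0` and `ω([H^{tt'}_{Λ_1}, ΓA]) = 0` in
every canonical-class minimiser `ω` (density `ρ ∈ (0,2)`). [cite: BratteliKishimotoRobinson1978, Thm. 2 (p. 47)] -/
theorem canonicalMinimiser_ttPrime_kkt_of_commute_number {t t' U : ℝ} {ω : InfVolFermionState 2}
    (hω : ω.IsTranslationInvariant) {ρ : ℝ} (hρ : ω.density = ρ) (hρ0 : 0 < ρ) (hρ2 : ρ < 2)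
    (hmin : ∀ σ : InfVolFermionState 2, σ.IsTranslationInvariant → σ.density = ρ →
      ω.meanEnergy (hubbardTTPrimeFermionInteraction t t' U) 1 ≤
        σ.meanEnergy (hubbardTTPrimeFermionInteraction t t' U) 1)
    (Λ : Finset (Site 2)) (A : FermionOp Λ)
    (hA : Commute ((numberInteraction 2).localHamiltonian (thicken Λ 1))
      (fermionEmbed (PolySite.incl (subset_thicken Λ 1)) A)) :
    0 ≤ (ω.expect (thicken Λ 1) ((fermionEmbed (PolySite.incl (subset_thicken Λ 1)) A)ᴴ *
        ((hubbardTTPrimeFermionInteraction t t' U).localHamiltonian (thicken Λ 1) *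
            fermionEmbed (PolySite.incl (subset_thicken Λ 1)) A -
          fermionEmbed (PolySite.incl (subset_thicken Λ 1)) A *
            (hubbardTTPrimeFermionInteraction t t' U).localHamiltonian (thicken Λ 1)))).re ∧
      ω.expect (thicken Λ 1)
        ((hubbardTTPrimeFermionInteraction t t' U).localHamiltonian (thicken Λ 1) *
            fermionEmbed (PolySite.incl (subset_thicken Λ 1)) A -
          fermionEmbed (PolySite.incl (subset_thicken Λ 1)) A *
            (hubbardTTPrimeFermionInteraction t t' U).localHamiltonian (thicken Λ 1)) = 0 :=
  canonicalMinimiser_kkt_of_commute_number zero_le_one (hubbardTTPrimeFermionInteraction_isHermitian t t' U)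
    (hubbardTTPrimeFermionInteraction_isEven t t' U) (hubbardTTPrimeFermionInteraction_isTranslationInvariant t t' U)
    (hubbardTTPrimeFermionInteraction_hasFiniteRange t t' U) hω hρ hρ0 hρ2 hmin Λ A hA

/-- **Every filling `ρ ∈ (0,2)` is realised by a translation-invariant ground state of `H^{tt'} − μN` for some
`μ`** (a fixed-filling minimiser and its chemical potential). [cite: BratteliKishimotoRobinson1978, Thm. 2 (p. 47)] -/
theorem exists_isGroundState_hubbardTTPrimeMu_of_density (t t' U : ℝ) {ρ : ℝ} (hρ0 : 0 < ρ) (hρ2 : ρ < 2) :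
    ∃ (μ : ℝ) (ω : InfVolFermionState 2), ω.IsTranslationInvariant ∧ ω.density = ρ ∧
      ω.IsMeanEnergyMinimiser (hubbardTTPrimeMuInteraction t t' U μ) 1 ∧
      ω.IsGroundState (hubbardTTPrimeMuInteraction t t' U μ) 1 :=
  exists_isGroundState_pencil_number_of_density zero_le_one (hubbardTTPrimeFermionInteraction_isHermitian t t' U)
    (hubbardTTPrimeFermionInteraction_isEven t t' U) (hubbardTTPrimeFermionInteraction_isTranslationInvariant t t' U)
    (hubbardTTPrimeFermionInteraction_hasFiniteRange t t' U) hρ0 hρ2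

/-! ### §3. The pair-sourced `t–t'` Hubbard model, by name -/

section Sourced

variable {t t' U : ℝ} {g : Site 2 → ℝ} {h : ℝ}

/-- **Fixed-density minimisers of the pair-sourced `t–t'` energy are minimisers and ground states of
`hubbardTTPrimeSourcedInteraction t t' U μ g h` for some `μ`**: if `ω` is translation invariant of density
`ρ ∈ (0,2)` and minimises the mean energy of `Ψ_h = hubbardTTPrimeSourcedInteraction t t' U 0 g h` among
translation-invariant states of density `ρ` (the canonical sourced class of the cell's response floors), then for
some chemical potential `μ` it is a mean-energy minimiser and a Bratteli–Robinson ground state of the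
grand-canonical sourced interaction `Φ(t,t',U) − μn − hP_g` (the `μ`-pencil of `Ψ_h`,
`hubbardTTPrimeSourcedInteraction_eq_pencil_number`). [cite: BratteliKishimotoRobinson1978, Thm. 2 (p. 47)] [cite: KomaTasaki1994, §1] -/
theorem exists_isGroundState_hubbardTTPrimeSourced_of_canonicalMinimiser {ω : InfVolFermionState 2}
    (hω : ω.IsTranslationInvariant) {ρ : ℝ} (hρ : ω.density = ρ) (hρ0 : 0 < ρ) (hρ2 : ρ < 2)
    (hmin : ∀ σ : InfVolFermionState 2, σ.IsTranslationInvariant → σ.density = ρ →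
      ω.meanEnergy (hubbardTTPrimeSourcedInteraction t t' U 0 g h) 1 ≤
        σ.meanEnergy (hubbardTTPrimeSourcedInteraction t t' U 0 g h) 1) :
    ∃ μ : ℝ, ω.IsMeanEnergyMinimiser (hubbardTTPrimeSourcedInteraction t t' U μ g h) 1 ∧
      ω.IsGroundState (hubbardTTPrimeSourcedInteraction t t' U μ g h) 1 := by
  obtain ⟨μ, hμ⟩ := isMeanEnergyMinimiser_pencil_number_of_canonical
    (hubbardTTPrimeSourcedInteraction t t' U 0 g h) 1 hω hρ hρ0 hρ2 hmin
  rw [← hubbardTTPrimeSourcedInteraction_eq_pencil_number] at hμ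
  exact ⟨μ, hμ, hμ.isGroundState_ttPrimeSourced⟩

/-- The local Hamiltonians of the sourced model at chemical potential `μ`: `H^{src,μ}_Λ = H^{src,0}_Λ − μ N_Λ`.
[cite: KomaTasaki1994, §1] -/
theorem hubbardTTPrimeSourcedInteraction_localHamiltonian_eq_zero_sub (μ : ℝ) (Λ : Finset (Site 2)) :
    (hubbardTTPrimeSourcedInteraction t t' U μ g h).localHamiltonian Λ =
      (hubbardTTPrimeSourcedInteraction t t' U 0 g h).localHamiltonian Λ +
        ((-μ : ℝ) : ℂ) • (numberInteraction 2).localHamiltonian Λ := by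
  rw [hubbardTTPrimeSourcedInteraction_eq_pencil_number t t' U μ g h, localHamiltonian_pencil]

/-- For a number-conserving observable the commutator with the sourced Hamiltonian does not see `μ`:
`[H^{src,μ}_Λ, A] = [H^{src,0}_Λ, A]` for `A` commuting with `N_Λ`. [cite: KomaTasaki1994, §1] -/
theorem hubbardTTPrimeSourcedInteraction_commutator_eq_of_commute (μ : ℝ) (Λ : Finset (Site 2))
    {A : FermionOp Λ} (hA : Commute ((numberInteraction 2).localHamiltonian Λ) A) :
    (hubbardTTPrimeSourcedInteraction t t' U μ g h).localHamiltonian Λ * A -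
        A * (hubbardTTPrimeSourcedInteraction t t' U μ g h).localHamiltonian Λ =
      (hubbardTTPrimeSourcedInteraction t t' U 0 g h).localHamiltonian Λ * A -
        A * (hubbardTTPrimeSourcedInteraction t t' U 0 g h).localHamiltonian Λ := by
  rw [hubbardTTPrimeSourcedInteraction_eq_pencil_number t t' U μ g h]
  exact pencil_number_commutator_eq_of_commute _ μ Λ hA

/-- **KKT rows of the canonical sourced class** (with its chemical potential): for some `μ`, every local `A`
satisfies `Re ω((ΓA)⋆[H^{src,μ}_{Λ_1}, ΓA]) ≥ 0` and `ω([H^{src,μ}_{Λ_1}, ΓA]) = 0`,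
`H^{src,μ} = H^{tt'} − μN − hP_g` — charged and odd words included. [cite: BratteliKishimotoRobinson1978, Thm. 2 (p. 47)] -/
theorem canonicalMinimiser_ttPrimeSourced_kkt {ω : InfVolFermionState 2}
    (hω : ω.IsTranslationInvariant) {ρ : ℝ} (hρ : ω.density = ρ) (hρ0 : 0 < ρ) (hρ2 : ρ < 2)
    (hmin : ∀ σ : InfVolFermionState 2, σ.IsTranslationInvariant → σ.density = ρ →
      ω.meanEnergy (hubbardTTPrimeSourcedInteraction t t' U 0 g h) 1 ≤
        σ.meanEnergy (hubbardTTPrimeSourcedInteraction t t' U 0 g h) 1) :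
    ∃ μ : ℝ, ∀ (Λ : Finset (Site 2)) (A : FermionOp Λ),
      0 ≤ (ω.expect (thicken Λ 1) ((fermionEmbed (PolySite.incl (subset_thicken Λ 1)) A)ᴴ *
        ((hubbardTTPrimeSourcedInteraction t t' U μ g h).localHamiltonian (thicken Λ 1) *
            fermionEmbed (PolySite.incl (subset_thicken Λ 1)) A -
          fermionEmbed (PolySite.incl (subset_thicken Λ 1)) A *
            (hubbardTTPrimeSourcedInteraction t t' U μ g h).localHamiltonian (thicken Λ 1)))).re ∧
      ω.expect (thicken Λ 1)
        ((hubbardTTPrimeSourcedInteraction t t' U μ g h).localHamiltonian (thicken Λ 1) *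
            fermionEmbed (PolySite.incl (subset_thicken Λ 1)) A -
          fermionEmbed (PolySite.incl (subset_thicken Λ 1)) A *
            (hubbardTTPrimeSourcedInteraction t t' U μ g h).localHamiltonian (thicken Λ 1)) = 0 := by
  obtain ⟨μ, -, hgs⟩ := exists_isGroundState_hubbardTTPrimeSourced_of_canonicalMinimiser hω hρ hρ0 hρ2 hmin
  exact ⟨μ, fun Λ A => ⟨hgs.re_expect_conj_commutator_nonneg Λ A, hgs.expect_commutator_localHamiltonian_eq_zero Λ A⟩⟩

/-- **`μ`-free KKT rows of the canonical sourced class**: for every local `A` commuting with the local particle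
number `N_{Λ_1}` (number-conserving words), every density-`ρ` minimiser of the sourced energy
`Ψ_h = hubbardTTPrimeSourcedInteraction t t' U 0 g h` satisfies `Re ω((ΓA)⋆[H^{Ψ_h}_{Λ_1}, ΓA]) ≥ 0` and
`ω([H^{Ψ_h}_{Λ_1}, ΓA]) = 0` — the rows of the `μ = 0` sourced Hamiltonian itself.
[cite: BratteliKishimotoRobinson1978, Thm. 2 (p. 47)] -/
theorem canonicalMinimiser_ttPrimeSourced_kkt_of_commute_number {ω : InfVolFermionState 2}
    (hω : ω.IsTranslationInvariant) {ρ : ℝ} (hρ : ω.density = ρ) (hρ0 : 0 < ρ) (hρ2 : ρ < 2)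
    (hmin : ∀ σ : InfVolFermionState 2, σ.IsTranslationInvariant → σ.density = ρ →
      ω.meanEnergy (hubbardTTPrimeSourcedInteraction t t' U 0 g h) 1 ≤
        σ.meanEnergy (hubbardTTPrimeSourcedInteraction t t' U 0 g h) 1)
    (Λ : Finset (Site 2)) (A : FermionOp Λ)
    (hA : Commute ((numberInteraction 2).localHamiltonian (thicken Λ 1))
      (fermionEmbed (PolySite.incl (subset_thicken Λ 1)) A)) :
    0 ≤ (ω.expect (thicken Λ 1) ((fermionEmbed (PolySite.incl (subset_thicken Λ 1)) A)ᴴ *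
        ((hubbardTTPrimeSourcedInteraction t t' U 0 g h).localHamiltonian (thicken Λ 1) *
            fermionEmbed (PolySite.incl (subset_thicken Λ 1)) A -
          fermionEmbed (PolySite.incl (subset_thicken Λ 1)) A *
            (hubbardTTPrimeSourcedInteraction t t' U 0 g h).localHamiltonian (thicken Λ 1)))).re ∧
      ω.expect (thicken Λ 1)
        ((hubbardTTPrimeSourcedInteraction t t' U 0 g h).localHamiltonian (thicken Λ 1) *
            fermionEmbed (PolySite.incl (subset_thicken Λ 1)) A -
          fermionEmbed (PolySite.incl (subset_thicken Λ 1)) A *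
            (hubbardTTPrimeSourcedInteraction t t' U 0 g h).localHamiltonian (thicken Λ 1)) = 0 := by
  obtain ⟨μ, hkkt⟩ := canonicalMinimiser_ttPrimeSourced_kkt hω hρ hρ0 hρ2 hmin
  obtain ⟨h2, h1⟩ := hkkt Λ A
  rw [hubbardTTPrimeSourcedInteraction_commutator_eq_of_commute μ (thicken Λ 1) hA] at h2 h1
  exact ⟨h2, h1⟩

/-- **Every density `ρ ∈ (0,2)` is realised by a translation-invariant ground state of the sourced
grand-canonical interaction `hubbardTTPrimeSourcedInteraction t t' U μ g h` for some `μ`**: the canonical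
sourced class at `ρ` has a minimiser (`exists_canonicalMinimiser`) and that minimiser has a chemical potential.
[cite: BratteliKishimotoRobinson1978, Thm. 2 (p. 47)] [cite: Ruelle1969, §3.4] -/
theorem exists_isGroundState_hubbardTTPrimeSourced_of_density (t t' U : ℝ) (g : Site 2 → ℝ) (h : ℝ) {ρ : ℝ}
    (hρ0 : 0 < ρ) (hρ2 : ρ < 2) :
    ∃ (μ : ℝ) (ω : InfVolFermionState 2), ω.IsTranslationInvariant ∧ ω.density = ρ ∧
      ω.IsMeanEnergyMinimiser (hubbardTTPrimeSourcedInteraction t t' U μ g h) 1 ∧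
      ω.IsGroundState (hubbardTTPrimeSourcedInteraction t t' U μ g h) 1 := by
  obtain ⟨ω, hω, hρ, hmin⟩ := exists_canonicalMinimiser (hubbardTTPrimeSourcedInteraction t t' U 0 g h) 1 hρ0 hρ2
  obtain ⟨μ, hmm, hgs⟩ := exists_isGroundState_hubbardTTPrimeSourced_of_canonicalMinimiser hω hρ hρ0 hρ2 hmin
  exact ⟨μ, ω, hω, hρ, hmm, hgs⟩

end Sourced

end InfVolFermionState

end Literature.MathematicalPhysics.QuantumLattice
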